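import Summits.FinalStateConjecture.FinalStateConjecture.Theorems.SwallowTheDatumSubdataDevelopmentsEmbedLocalisationMaximal
import Literature.Geometry.Lorentzian.CauchyProblemLocalUniqueness
import Literature.Geometry.Lorentzian.CauchyDevelopmentGlobalHyperbolicityProofs

/-!
# Route SwallowTheDatum · item `SubdataDevelopmentsEmbed` (stmt-FinalStateConjecture-10053) —
# line B with the registered facts: MGHD existence for developable data, or local uniqueness +
# Theorem 12, and nothing else

Final assembly of the Theorem-12-free localisation line (`…Localisation.lean`,
`…LocalisationMaximal.lean`) with the global hyperbolicity of Cauchy developments DISCHARGED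
(`hawkingEllis_cauchyDevelopment_causalCompact_closed_holds`, `CauchyDevelopmentGlobalHyperbolicityProofs`;
Hawking–Ellis 1973, Prop. 6.6.6, O'Neill 1983, Lemma 14.22 — theorems of the tree):

* `subdataDevelopmentsEmbed_of_exists_isMaximal` — **the item from MGHD existence for developable
  data alone** (hypothesis `hmaxdev` = `hmax` of `subdataDevelopmentsEmbed_iff_relative_extension`);
* `exists_isCommonDevelopment_of_locallyUnique` — the named local-uniqueness fact
  `hawkingEllis_locallyUnique_vacuumDevelopment` (Hawking–Ellis 1973, §7.5; Sbierski 2016,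
  Thm. 2.4 (ii)) in the realised shape `∃ U, IsCommonDevelopment 𝒟₁ 𝒟₂ U` consumed by the
  MCGHD / gluing files (Sbierski 2016, Def. 2.4, Remark (2); `exists_realised_of_embedsInto`);
* `subdataDevelopmentsEmbed_of_locallyUnique_of_thm12_viaMGHD` — **the item from the named
  local-uniqueness fact and Sbierski's Theorem 12 for developments of the SAME data**, through
  the maximal development of the sub-datum (`subdataDevelopmentsEmbed_of_localTheory_of_thm12_of_causalCompact`):
  a derivation independent of the relative no-corresponding-boundary theorem of `…NcbReduction.lean`,
  arriving at the same two inputs — both resting on the hyperbolic PDE theory of the vacuum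
  Einstein equations (Hawking–Ellis 1973, §7.4–7.5), the second also on the unformalised part of
  Sbierski 2016, §3.2.

Pure composition; no definition; no new named fact (the hypotheses are registered facts or
displayed printed theorems).
-/

noncomputable section

open Function Set Filter Topology TopologicalSpace Bundle
open scoped Manifold ContDiff Topology

namespace Summit.FinalStateConjecture.FinalStateConjecture.Theorems

namespace SubdataDevelopmentsEmbed

open Literature.Geometry.Lorentzian

/-- **`SubdataDevelopmentsEmbed` from MGHD existence for DEVELOPABLE data alone**: every datum on
a connected Hausdorff second countable `3`-manifold admitting a vacuum Cauchy development admits a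
maximal one ⇒ the item (`subdataDevelopmentsEmbed_of_exists_isMaximal_of_causalCompact` with the
global hyperbolicity of Cauchy developments supplied by the theorem
`hawkingEllis_cauchyDevelopment_causalCompact_closed_holds`). Hawking–Ellis 1973, §7.6, p. 251;
Choquet-Bruhat–Geroch 1969, Thm. 3 and p. 334. [cite: HawkingEllis1973CUP, §7.6, pp. 249–251] -/
theorem subdataDevelopmentsEmbed_of_exists_isMaximal
    (hmaxdev : ∀ (N : Type) [TopologicalSpace N] [ChartedSpace E3 N] [IsManifold (𝓡 3) ∞ N]
      [T2Space N] [SecondCountableTopology N] [ConnectedSpace N] (D₁ : InitialDataSet (𝓡 3) N),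
      Nonempty (VacuumCauchyDevelopment D₁) → ∃ M : VacuumCauchyDevelopment D₁, M.IsMaximal) :
    Summit.FinalStateConjecture.FinalStateConjecture.Theses.SwallowTheDatum.SubdataDevelopmentsEmbed :=
  subdataDevelopmentsEmbed_of_exists_isMaximal_of_causalCompact hmaxdev
    hawkingEllis_cauchyDevelopment_causalCompact_closed_holds

/-- **Local geometric uniqueness in the realised shape**: under the named fact
`hawkingEllis_locallyUnique_vacuumDevelopment` (any two vacuum Cauchy developments of a datum
are extensions of a common one; Hawking–Ellis 1973, §7.5; Sbierski 2016, Thm. 2.4 (ii)), any two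
vacuum Cauchy developments `𝒟₁`, `𝒟₂` of data on a connected `3`-manifold `N` have a common
globally hyperbolic development REALISED in `𝒟₁` (`CauchyDevelopment.IsCommonDevelopment`,
Sbierski 2016, Def. 2.4 and Remark (2): the image `j(𝒰)` of the common development `𝒰` under its
embedding into `𝒟₁`, with the immersion `k ∘ j⁻¹`; `exists_realised_of_embedsInto`). `N` is
Hausdorff and second countable as an embedded hypersurface of `M₁`.
[cite: Sbierski2016AHP, §2, Def. 2.4, Remark (2) and Thm. 2.4 (ii)] -/
theorem exists_isCommonDevelopment_of_locallyUnique (h : hawkingEllis_locallyUnique_vacuumDevelopment)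
    (N : Type) [TopologicalSpace N] [ChartedSpace E3 N] [IsManifold (𝓡 3) ∞ N]
    [ConnectedSpace N] (D₁ : InitialDataSet (𝓡 3) N) (𝒟₁ 𝒟₂ : VacuumCauchyDevelopment D₁) :
    ∃ U : Opens 𝒟₁.carrier, 𝒟₁.toCauchyDevelopment.IsCommonDevelopment 𝒟₂.toDataEmbedding U := by
  haveI : T2Space N := 𝒟₁.isSmoothEmbedding.isEmbedding.t2Space
  haveI : SecondCountableTopology N := 𝒟₁.isSmoothEmbedding.isEmbedding.secondCountableTopology
  obtain ⟨𝒰, h₁, h₂⟩ := h N D₁ 𝒟₁ 𝒟₂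
  obtain ⟨U, ψ, hι, -, hC, hs, hi, ht, hc⟩ :=
    exists_realised_of_embedsInto 𝒟₁.toCauchyDevelopment 𝒟₂.toCauchyDevelopment
      𝒰.toCauchyDevelopment h₁ h₂
  -- `ψ ∘ Subtype.val` is a t.o.p. isometric immersion of `(U, g₁|_U)` into `𝒟₂`
  have hsmooth : ContMDiff (𝓡 4) (𝓡 4) ∞ (ψ ∘ (Subtype.val : U → 𝒟₁.carrier)) :=
    hs.comp_contMDiff contMDiff_subtype_val fun p ↦ p.2
  have hmf : ∀ (y : U) (v : TangentSpace (𝓡 4) y),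
      mfderiv (𝓡 4) (𝓡 4) (ψ ∘ (Subtype.val : U → 𝒟₁.carrier)) y v =
        mfderiv (𝓡 4) (𝓡 4) ψ y.1 v := by
    intro y v
    have hd : MDifferentiableAt (𝓡 4) (𝓡 4) ψ y.1 :=
      ((hs y.1 y.2).contMDiffAt (U.2.mem_nhds y.2)).mdifferentiableAt (by simp)
    rw [mfderiv_comp y hd
      (hasMFDerivAt_subtypeVal (I' := 𝓡 4) (W := U) y).mdifferentiableAt, mfderiv_subtypeVal]
    rfl
  have hiso : (𝒟₁.metric.restrict PseudoRiemannianMetric.contMDiff_restrict_holds U).IsIsometricImmersion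
      𝒟₂.metric.toPseudoRiemannianMetric (ψ ∘ (Subtype.val : U → 𝒟₁.carrier)) := by
    refine ⟨hsmooth, fun (y : U) ↦ ?_⟩
    ext v w
    have hk := congrArg (fun b ↦ b v w) (hi y.1 y.2)
    simp only [pullbackBilin_apply] at hk
    change 𝒟₂.metric.val (ψ y.1)
        (mfderiv (𝓡 4) (𝓡 4) (ψ ∘ (Subtype.val : U → 𝒟₁.carrier)) y v)
        (mfderiv (𝓡 4) (𝓡 4) (ψ ∘ (Subtype.val : U → 𝒟₁.carrier)) y w) =
      𝒟₁.metric.val y.1 v w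
    rw [hmf y v, hmf y w]
    exact hk
  have hτ : (𝒟₁.timeOrientation.restrict PseudoRiemannianMetric.contMDiff_restrict_holds
      𝒟₁.timeOrientation.contMDiff_restrict_holds U).PreservesTimeOrientation
      (ψ ∘ (Subtype.val : U → 𝒟₁.carrier)) 𝒟₂.timeOrientation := fun (y : U) ↦ by
    change 𝒟₂.timeOrientation.IsFutureDirected
      (mfderiv (𝓡 4) (𝓡 4) (ψ ∘ (Subtype.val : U → 𝒟₁.carrier)) y
        (𝒟₁.timeOrientation.vectorField y.1))
    rw [hmf]
    exact ht y.1 y.2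
  exact ⟨U, hι, hC, ψ ∘ Subtype.val, hiso, hτ, funext fun u ↦ congrFun hc u⟩


/-- **`SubdataDevelopmentsEmbed` from the named fact of local geometric uniqueness and Sbierski's
Theorem 12 for developments of the same data, via the maximal development of the sub-datum**:
`subdataDevelopmentsEmbed_of_localTheory_of_thm12_of_causalCompact` with the local theory supplied
by `exists_isCommonDevelopment_of_locallyUnique` and global hyperbolicity by
`hawkingEllis_cauchyDevelopment_causalCompact_closed_holds`. The displayed `h12` is Sbierski 2016,
Thm. 3.5 = arXiv Thm. 12 (a common globally hyperbolic development with corresponding boundary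
points is strictly contained in a larger one), in the shape of `MCGHDNoCorrespondingBoundary.lean`.
[cite: Sbierski2016AHP, Thm. 2.4 (ii), Thm. 3.5 (arXiv Thm. 12) and §3.3]
[cite: HawkingEllis1973CUP, §7.5, pp. 248–249 and §7.6, pp. 249–251] -/
theorem subdataDevelopmentsEmbed_of_locallyUnique_of_thm12_viaMGHD
    (h : hawkingEllis_locallyUnique_vacuumDevelopment)
    (h12 : ∀ (N : Type) [TopologicalSpace N] [ChartedSpace E3 N] [IsManifold (𝓡 3) ∞ N]
      [ConnectedSpace N] (D₁ : InitialDataSet (𝓡 3) N) (𝒟₁ 𝒟₂ : VacuumCauchyDevelopment D₁)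
      (𝔠 : CauchyDevelopment.CommonDevelopment 𝒟₁.toCauchyDevelopment 𝒟₂.toCauchyDevelopment),
      𝔠.HasCorrespondingBoundaryPoints →
        ∃ V : Opens 𝒟₁.carrier,
          𝒟₁.toCauchyDevelopment.IsCommonDevelopment 𝒟₂.toDataEmbedding V ∧ 𝔠.opens < V) :
    Summit.FinalStateConjecture.FinalStateConjecture.Theses.SwallowTheDatum.SubdataDevelopmentsEmbed :=
  subdataDevelopmentsEmbed_of_localTheory_of_thm12_of_causalCompact
    (exists_isCommonDevelopment_of_locallyUnique h) h12
    hawkingEllis_cauchyDevelopment_causalCompact_closed_holds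

end SubdataDevelopmentsEmbed

end Summit.FinalStateConjecture.FinalStateConjecture.Theorems

end
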